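import Summits.HodgeConjecture.HodgeConjecture.Theorems.F0P3ArchValueMapRigidity
import HarnessLib

/-!
# FLOOR-0 P3 — rung-1 brick S2 (junction adapter, algebraic half): transport of typed null VALUE MAPS along
# `(𝔤, K)`-equivariant linear maps, and E2′₀ ∕ (E)h-arch for modules DETECTED by an irreducible one

Cell hodgecm-mathlib, FLOOR 0, crux item H413 = stmt-HodgeConjecture-24833; integrator brief F0P3-plan (g0) 2026-08-31T00:04:48Z ∕
00:09:04Z («S2: the adapter between J1's value map on `P.archModule ι` (D4, F0-typ3) and the irreducible-module theorems of
S0»).  PROOF lane (no `def`); author F0P3-p03 (g2).  Pure pair-datum algebra over `U(α, β)` — it mentions neither D4 nor F1a: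
F1a's planned shape ([Flath1979 Thm 3] «∃ an irreducible `M` such that every non-zero `v ∈ P.archModule` is detected by a
`(𝔤, K)`-hom `P.archModule → M`», design `F0/P3/D4F1F2-DESIGN.v0` §2) is consumed here as the explicit hypothesis `hdet` on plain
`ℂ`-linear maps with equivariance hypotheses (the currency of ★ `GKEquiv.map_ρK ∕ map_ρ𝔤` and ★ `F0P3bGKPairGlue.isGKSubmodule_map`),
so ANY final F1a shape plugs in with one line.  «Typed-`δ` null value map» = the five explicit hypotheses h0∕hK∕h𝔨∕hwt∕hN of
★ `F0P3ArchValueMapRigidity` (no def).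
* §1 `valueMap_comp`: if `φ : 𝔤 →ₗ[ℝ] V` is a typed-`δ` null value map for `(ρK, ρ𝔤)` and `T : V →ₗ[ℂ] M` intertwines `(ρK, ρ𝔤)`
  with `(σK, σ𝔤)`, then `T ∘ φ` is a typed-`δ` null value map for `(σK, σ𝔤)`; `comp_ne_zero_of_apply_ne_zero`.
* §2 `not_both_types_of_detected` (E2′₀-arch for DETECTED modules, generic `U(α, β)`): if the non-zero vectors of `V` are detected
  by equivariant maps into ONE irreducible pair datum `M` (`hV_M`-compatible, `IsIrreducibleGK`), then `V` carries no non-zero typed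
  null value maps of both types `+1` and `−1` (★ S0 `not_both_types_of_valueMaps` on `M`).  NO hypothesis on `V` itself.
* §3 `exists_valueMap_irreducible_of_detected` ((E)h-arch input): a non-zero typed-`δ` null value map on such a `V` yields a
  non-zero one on the irreducible `M` (then ★ S0 `exists_smul_eq_of_valueMaps` ∕ `finrank_valueMaps_le_two` apply on `M`).
References: D. Flath, Decomposition of representations into tensor products, Corvallis 1979, Thm. 3 [Flath1979]; Borel–Wallach, AMS 2000,
VI Thm. 4.11 [BorelWallach2000]; Rogawski, Princeton 1990, §15.3 ¶1, Prop. 15.2.1 (b) [Rogawski1990].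
HONEST LABEL: HC_CM is proved only modulo the printed citations until rung 0 closes; this file discharges none of them.
-/

-- Mathlib idiom (as in `GKModules`, `GKCohomology`, the `Upq*` files and the Lines file): commutator bracket on `Module.End`
attribute [local instance 100] LieRing.ofAssociativeRing

set_option autoImplicit false
set_option linter.dupNamespace false

noncomputable section

namespace Summit.HodgeConjecture.HodgeConjecture.Cruxes.H413.F0P3ValueMapTransport

open Literature.Algebra.Lie Literature.Algebra.Lie.ChevalleyEilenberg
open Literature.NumberTheory.Automorphic
open Literature.RepresentationTheory.BorelWallach2000
open Literature.RepresentationTheory.KonnoKonno2007 Literature.RepresentationTheory.KonnoKonno2007.RealDualPair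
open Literature.RepresentationTheory.KonnoKonno2007.RealDualPair.UForm
open Summit.HodgeConjecture.HodgeConjecture.Cruxes.H413.F0P3ArchValueMapRigidity

section Transport

variable {α β : Type} [Fintype α] [DecidableEq α] [Fintype β] [DecidableEq β]
  {V : Type} [AddCommGroup V] [Module ℂ V]
  {ρK : Representation ℂ (uFormGroup α β).maximalCompact V}
  {ρ𝔤 : (uFormGroup α β).lie →ₗ⁅ℝ⁆ Module.End ℂ V}
  {M : Type} [AddCommGroup M] [Module ℂ M]
  {σK : Representation ℂ (uFormGroup α β).maximalCompact M}
  {σ𝔤 : (uFormGroup α β).lie →ₗ⁅ℝ⁆ Module.End ℂ M}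

/-! ## §1 Transport of typed null value maps along equivariant linear maps -/

/-- **Transport**: a typed-`δ` null value map `φ` for `(ρK, ρ𝔤)` composed with a `ℂ`-linear `T : V → M` intertwining
`(ρK, ρ𝔤)` with `(σK, σ𝔤)` is a typed-`δ` null value map for `(σK, σ𝔤)` (all five conditions are equations between
values, preserved by `T`). [cite: BorelWallach2000, I §5.1; KnappVogan1995, §II.4] -/
theorem valueMap_comp {δ : ℤ} (φ : (uFormGroup α β).lie →ₗ[ℝ] V) (T : V →ₗ[ℂ] M)
    (hTK : ∀ (k : (uFormGroup α β).maximalCompact) (v : V), T (ρK k v) = σK k (T v))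
    (hT𝔤 : ∀ (X : (uFormGroup α β).lie) (v : V), T (ρ𝔤 X v) = σ𝔤 X (T v))
    (h0 : ∀ W ∈ (uFormGroup α β).kInLie, φ W = 0)
    (hK : ∀ (k : (uFormGroup α β).maximalCompact) (X : (uFormGroup α β).lie),
      ρK k (φ X) = φ ((uFormGroup α β).Ad (Subgroup.inclusion (uFormGroup α β).maximalCompact_le_carrier k) X))
    (h𝔨 : ∀ W ∈ (uFormGroup α β).kInLie, ∀ X : (uFormGroup α β).lie, φ ⁅W, X⁆ = ρ𝔤 W (φ X))
    (hwt : ∀ X : (uFormGroup α β).lie, ρ𝔤 (upqZ0 α β) (φ X) = ((δ : ℂ) * Complex.I) • φ X)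
    (hN : ∀ (X : (uFormGroup α β).lie) (s : (α × β) × Fin 2),
      ρ𝔤 (upqPBasis s) (φ X) + ((δ : ℂ) * Complex.I) • ρ𝔤 ⁅upqZ0 α β, upqPBasis s⁆ (φ X) = 0) :
    (∀ W ∈ (uFormGroup α β).kInLie, (T.restrictScalars ℝ ∘ₗ φ) W = 0) ∧
    (∀ (k : (uFormGroup α β).maximalCompact) (X : (uFormGroup α β).lie),
      σK k ((T.restrictScalars ℝ ∘ₗ φ) X) =
        (T.restrictScalars ℝ ∘ₗ φ) ((uFormGroup α β).Ad (Subgroup.inclusion (uFormGroup α β).maximalCompact_le_carrier k) X)) ∧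
    (∀ W ∈ (uFormGroup α β).kInLie, ∀ X : (uFormGroup α β).lie,
      (T.restrictScalars ℝ ∘ₗ φ) ⁅W, X⁆ = σ𝔤 W ((T.restrictScalars ℝ ∘ₗ φ) X)) ∧
    (∀ X : (uFormGroup α β).lie, σ𝔤 (upqZ0 α β) ((T.restrictScalars ℝ ∘ₗ φ) X) =
      ((δ : ℂ) * Complex.I) • (T.restrictScalars ℝ ∘ₗ φ) X) ∧
    (∀ (X : (uFormGroup α β).lie) (s : (α × β) × Fin 2),
      σ𝔤 (upqPBasis s) ((T.restrictScalars ℝ ∘ₗ φ) X) +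
        ((δ : ℂ) * Complex.I) • σ𝔤 ⁅upqZ0 α β, upqPBasis s⁆ ((T.restrictScalars ℝ ∘ₗ φ) X) = 0) := by
  have hc : ∀ X : (uFormGroup α β).lie, (T.restrictScalars ℝ ∘ₗ φ) X = T (φ X) := fun X => rfl
  refine ⟨fun W hW => ?_, fun k X => ?_, fun W hW X => ?_, fun X => ?_, fun X s => ?_⟩
  · rw [hc, h0 W hW, map_zero]
  · rw [hc, hc, ← hTK, hK]
  · rw [hc, hc, ← hT𝔤, h𝔨 W hW X]
  · rw [hc, ← hT𝔤, hwt X, map_smul]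
  · rw [hc, ← hT𝔤, ← hT𝔤, ← map_smul, ← map_add, hN X s, map_zero]

/-- A composite `T ∘ φ` with a detected value is non-zero. [folklore] -/
theorem comp_ne_zero_of_apply_ne_zero (φ : (uFormGroup α β).lie →ₗ[ℝ] V) (T : V →ₗ[ℂ] M)
    {X₀ : (uFormGroup α β).lie} (h : T (φ X₀) ≠ 0) : T.restrictScalars ℝ ∘ₗ φ ≠ 0 := fun h0 =>
  h (by have e := LinearMap.congr_fun h0 X₀; exact e)

/-- A non-zero linear map has a non-zero value. [folklore] -/
theorem exists_apply_ne_zero_of_ne_zero {φ : (uFormGroup α β).lie →ₗ[ℝ] V} (hφ : φ ≠ 0) :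
    ∃ X₀ : (uFormGroup α β).lie, φ X₀ ≠ 0 := by
  by_contra h
  push Not at h
  exact hφ (LinearMap.ext fun X => by rw [h X, LinearMap.zero_apply])

end Transport

/-! ## §2 E2′₀-arch for modules detected by an irreducible one (generic `U(α, β)`) -/

section Detected

variable {α β : Type} [Fintype α] [DecidableEq α] [Fintype β] [DecidableEq β]
  {V : Type} [AddCommGroup V] [Module ℂ V]
  (ρK : Representation ℂ (uFormGroup α β).maximalCompact V)
  (ρ𝔤 : (uFormGroup α β).lie →ₗ⁅ℝ⁆ Module.End ℂ V)
  {M : Type} [AddCommGroup M] [Module ℂ M]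
  (σK : Representation ℂ (uFormGroup α β).maximalCompact M)
  (σ𝔤 : (uFormGroup α β).lie →ₗ⁅ℝ⁆ Module.End ℂ M)
  (hM : ∀ (k : (uFormGroup α β).maximalCompact) (X : (uFormGroup α β).lie), σK k ∘ₗ σ𝔤 X ∘ₗ σK k⁻¹ =
    σ𝔤 ((uFormGroup α β).Ad (Subgroup.inclusion (uFormGroup α β).maximalCompact_le_carrier k) X))

include hM in
/-- **E2′₀-arch for a DETECTED module (generic `U(α, β)`)**: let `M` be an irreducible pair datum (`hM`, `IsIrreducibleGK`)
and suppose every non-zero vector of `V` is detected by a `ℂ`-linear map `V → M` intertwining `(ρK, ρ𝔤)` with `(σK, σ𝔤)`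
(F1a's archimedean isotypy, [Flath1979 Thm 3]).  Then `V` does not carry a non-zero typed null value map of type `+1`
together with one of type `−1` — no hypothesis on `V` itself. [cite: Rogawski1990, §15.3 ¶1; BorelWallach2000, VI Thm. 4.11] -/
theorem not_both_types_of_detected (hirr : IsIrreducibleGK σK σ𝔤)
    (hdet : ∀ v : V, v ≠ 0 → ∃ T : V →ₗ[ℂ] M,
      (∀ (k : (uFormGroup α β).maximalCompact) (w : V), T (ρK k w) = σK k (T w)) ∧
      (∀ (X : (uFormGroup α β).lie) (w : V), T (ρ𝔤 X w) = σ𝔤 X (T w)) ∧ T v ≠ 0)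
    (φp φm : (uFormGroup α β).lie →ₗ[ℝ] V)
    (hp0 : ∀ W ∈ (uFormGroup α β).kInLie, φp W = 0)
    (hpK : ∀ (k : (uFormGroup α β).maximalCompact) (X : (uFormGroup α β).lie),
      ρK k (φp X) = φp ((uFormGroup α β).Ad (Subgroup.inclusion (uFormGroup α β).maximalCompact_le_carrier k) X))
    (hp𝔨 : ∀ W ∈ (uFormGroup α β).kInLie, ∀ X : (uFormGroup α β).lie, φp ⁅W, X⁆ = ρ𝔤 W (φp X))
    (hpwt : ∀ X : (uFormGroup α β).lie, ρ𝔤 (upqZ0 α β) (φp X) = Complex.I • φp X)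
    (hpN : ∀ (X : (uFormGroup α β).lie) (s : (α × β) × Fin 2),
      ρ𝔤 (upqPBasis s) (φp X) + Complex.I • ρ𝔤 ⁅upqZ0 α β, upqPBasis s⁆ (φp X) = 0)
    (hm0 : ∀ W ∈ (uFormGroup α β).kInLie, φm W = 0)
    (hmK : ∀ (k : (uFormGroup α β).maximalCompact) (X : (uFormGroup α β).lie),
      ρK k (φm X) = φm ((uFormGroup α β).Ad (Subgroup.inclusion (uFormGroup α β).maximalCompact_le_carrier k) X))
    (hm𝔨 : ∀ W ∈ (uFormGroup α β).kInLie, ∀ X : (uFormGroup α β).lie, φm ⁅W, X⁆ = ρ𝔤 W (φm X))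
    (hmwt : ∀ X : (uFormGroup α β).lie, ρ𝔤 (upqZ0 α β) (φm X) = (-Complex.I) • φm X)
    (hmN : ∀ (X : (uFormGroup α β).lie) (s : (α × β) × Fin 2),
      ρ𝔤 (upqPBasis s) (φm X) + (-Complex.I) • ρ𝔤 ⁅upqZ0 α β, upqPBasis s⁆ (φm X) = 0)
    (hp : φp ≠ 0) (hm : φm ≠ 0) : False := by
  have e1 : (((1 : ℤ) : ℂ) * Complex.I) = Complex.I := by rw [Int.cast_one, one_mul]
  have e2 : (((-1 : ℤ) : ℂ) * Complex.I) = -Complex.I := by rw [Int.cast_neg, Int.cast_one, neg_one_mul]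
  obtain ⟨Xp, hXp⟩ := exists_apply_ne_zero_of_ne_zero hp
  obtain ⟨Xm, hXm⟩ := exists_apply_ne_zero_of_ne_zero hm
  obtain ⟨Tp, hTpK, hTp𝔤, hTp⟩ := hdet _ hXp
  obtain ⟨Tm, hTmK, hTm𝔤, hTm⟩ := hdet _ hXm
  obtain ⟨q0, qK, q𝔨, qwt, qN⟩ := valueMap_comp (δ := 1) φp Tp hTpK hTp𝔤 hp0 hpK hp𝔨
    (fun X => by rw [e1]; exact hpwt X) fun X s => by rw [e1]; exact hpN X s
  obtain ⟨r0, rK, r𝔨, rwt, rN⟩ := valueMap_comp (δ := -1) φm Tm hTmK hTm𝔤 hm0 hmK hm𝔨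
    (fun X => by rw [e2]; exact hmwt X) fun X s => by rw [e2]; exact hmN X s
  exact not_both_types_of_valueMaps σK σ𝔤 hM hirr _ _ q0 qK q𝔨 (fun X => by rw [← e1]; exact qwt X)
    (fun X s => by rw [← e1]; exact qN X s) r0 rK r𝔨 (fun X => by rw [← e2]; exact rwt X)
    (fun X s => by rw [← e2]; exact rN X s) (comp_ne_zero_of_apply_ne_zero φp Tp hTp)
    (comp_ne_zero_of_apply_ne_zero φm Tm hTm)

/-- **(E)h-arch input for a DETECTED module**: a non-zero typed-`δ` null value map on `V` yields a non-zero typed-`δ`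
null value map on the detecting irreducible `M` (to which ★ `exists_smul_eq_of_valueMaps` ∕ `finrank_valueMaps_le_two`
apply for `U(2,1)`). [cite: BorelWallach2000, VI Thm. 4.11 (3); Rogawski1990, Prop. 15.2.1 (b)] -/
theorem exists_valueMap_irreducible_of_detected {δ : ℤ}
    (hdet : ∀ v : V, v ≠ 0 → ∃ T : V →ₗ[ℂ] M,
      (∀ (k : (uFormGroup α β).maximalCompact) (w : V), T (ρK k w) = σK k (T w)) ∧
      (∀ (X : (uFormGroup α β).lie) (w : V), T (ρ𝔤 X w) = σ𝔤 X (T w)) ∧ T v ≠ 0)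
    (φ : (uFormGroup α β).lie →ₗ[ℝ] V) (hφ : φ ≠ 0)
    (h0 : ∀ W ∈ (uFormGroup α β).kInLie, φ W = 0)
    (hK : ∀ (k : (uFormGroup α β).maximalCompact) (X : (uFormGroup α β).lie),
      ρK k (φ X) = φ ((uFormGroup α β).Ad (Subgroup.inclusion (uFormGroup α β).maximalCompact_le_carrier k) X))
    (h𝔨 : ∀ W ∈ (uFormGroup α β).kInLie, ∀ X : (uFormGroup α β).lie, φ ⁅W, X⁆ = ρ𝔤 W (φ X))
    (hwt : ∀ X : (uFormGroup α β).lie, ρ𝔤 (upqZ0 α β) (φ X) = ((δ : ℂ) * Complex.I) • φ X)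
    (hN : ∀ (X : (uFormGroup α β).lie) (s : (α × β) × Fin 2),
      ρ𝔤 (upqPBasis s) (φ X) + ((δ : ℂ) * Complex.I) • ρ𝔤 ⁅upqZ0 α β, upqPBasis s⁆ (φ X) = 0) :
    ∃ ψ : (uFormGroup α β).lie →ₗ[ℝ] M, ψ ≠ 0 ∧
      (∀ W ∈ (uFormGroup α β).kInLie, ψ W = 0) ∧
      (∀ (k : (uFormGroup α β).maximalCompact) (X : (uFormGroup α β).lie),
        σK k (ψ X) = ψ ((uFormGroup α β).Ad (Subgroup.inclusion (uFormGroup α β).maximalCompact_le_carrier k) X)) ∧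
      (∀ W ∈ (uFormGroup α β).kInLie, ∀ X : (uFormGroup α β).lie, ψ ⁅W, X⁆ = σ𝔤 W (ψ X)) ∧
      (∀ X : (uFormGroup α β).lie, σ𝔤 (upqZ0 α β) (ψ X) = ((δ : ℂ) * Complex.I) • ψ X) ∧
      (∀ (X : (uFormGroup α β).lie) (s : (α × β) × Fin 2),
        σ𝔤 (upqPBasis s) (ψ X) + ((δ : ℂ) * Complex.I) • σ𝔤 ⁅upqZ0 α β, upqPBasis s⁆ (ψ X) = 0) := by
  obtain ⟨X₀, hX₀⟩ := exists_apply_ne_zero_of_ne_zero hφ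
  obtain ⟨T, hTK, hT𝔤, hT⟩ := hdet _ hX₀
  exact ⟨T.restrictScalars ℝ ∘ₗ φ, comp_ne_zero_of_apply_ne_zero φ T hT, valueMap_comp φ T hTK hT𝔤 h0 hK h𝔨 hwt hN⟩

end Detected

end Summit.HodgeConjecture.HodgeConjecture.Cruxes.H413.F0P3ValueMapTransport

end
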